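import Summits.QuantumFields.YangMills.Theorems.BalabanUVNodesK2V6Defs
import Summits.QuantumFields.YangMills.Theorems.BalabanUVNodesK2EndOfChain190OwnDrift

/-!
# Crux K2⁷ `EndpointGivenBR13SepCoPH` (stmt-QuantumFields-20543) — NODE O's OWN ONE-LOOP NUMBERS AT THE STAGE-13 RECORD BY NAME (`bOwn F θ`), the slope letter
# `sOwn F θ := θ.cβ · stepBal 2 F.L`, the run-wise (190)-chain text relative to a NAMED reference sequence (`RunChain190At`), and plan g83's booking (β3)
# «κ-free own-drift road» AS TWO TEXTS BY NAME — 1ᴼᴿ `RunChain190AtOwnNumbers`, 2ᴼᴰ `OwnNumbersDrift` — with the by-name composition to the crux decl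

Cell `ym-nodeO-ideate`, DEFINER seat `ym-nodeO-def-1` (gen 6; director-ym R361 ∕ №21).  `--kind definition --supports stmt-QuantumFields-20543 --as helper`; count-neutral.
Answers the NAMING half of plan g83's (q-K2-3) (pub-ymgap bus l.29644, 2026-08-28T05:49:32Z: «will you NAME `bOwn` (and `s⋆`) as tree objects … ?»); whether the cut
{1ᴼᴿ, 2ᴼᴰ} is NODE O's honest wall split is NODE O P3's ∕ the idea seats' word, NOT the definer's — §4 records the kernel facts that bear on it.
[I] = [Balaban1987RG1] Commun. Math. Phys. **109** (1987); [II] = [Balaban1988RG2Cluster] Commun. Math. Phys. **116** (1988).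

WHAT «NODE O's OWN ONE-LOOP NUMBERS» ARE IN THE TREE (located, nothing new).  The β of record at Stage 13 is `Node00.betaOfRecord₁₃ F 2 θ = betaOfMerged βm β⁰ θ.γ`
(`Node00/BetaOfRecord.lean` design (β); `Node00/Record13.lean`): EQUAL to the merged β `βm := betaMerged F (mergedTermFamilyMatT F 2 (TcanOfRecord F 2) (chiFixed29 F 2 θ.ν θ.ε₂₉)
θ.εbg) θ.ρ8 θ.bV` ON the box `]0, θ.γ]^{k+1}` and to the one-loop NUMBER `β⁰ := beta0OfMerged βm θ.v₀` OFF it, where `β⁰_k := limUnder (𝓝[>] 0) (g ↦ βm k (update (θ.v₀ k) last g))`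
(chair R434 (c3): junk unless `Node00.Beta0LimitExists βm θ.v₀`).  Hence (kernel facts, §1): the record's β AT THE ZERO HISTORY is `β⁰` (CRIT-2's `βfun_apply_zero`), and EVERY
`OneLoopSplit` of the record's β has `S.β0 = β⁰` (an4's `split_β0_eq_apply_zero`) — the object every split-based NODE-O road already reads (`…K2EndOfChain190OwnDrift` :84,
`…N26AtRecord13Core`, `…K2StubD4FlatSlope`, `…N17AtRecord13Sep` (AF-0r)), spelled there as a 150-character inline term.  THIS FILE names it `bOwn F θ` — nothing else is chosen.
LOCATED CAVEAT carried by the name (not hidden): `θ.v₀` is read by NO admissibility clause and NO proviso of Stages 8–13 (CRIT-2 `…Negative.Anchor13FalseOfTwoBaseHistories`,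
header; CRIT-1 sheet `Cruxes/EndpointGivenBR13SepCoPH/CRIT-1-jets-referenced-box.md` §1: the records of record put `v₀ := 0⃗`, a last-coupling path along the zero EDGE, outside
[I] Thm 3's domain `0 < g_k ≤ γ`), so a text keyed on `bOwn` asks its prover to control the record's β relative to THIS `limUnder` object; its existence as a limit,
history-independence and sign are N17 ∕ NODE O ∕ β-cell statements, never the definer's.  This is the SAME object skeleton 6c3fc4f2's stubs were keyed on (2026-08-27) before the
named-jets re-cut; (β3) returns to it deliberately («no identification of `b` with print's colour table», plan g83 WORDS-4) — §4 states what that moves where.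

CONTENTS (9 `def` + 26 theorems; 0 `sorry`; [folklore] bookkeeping BY NAME; no `instance`, no `notation`, no `axiom`):
* §1 `bOwn F θ : ℕ → ℝ := k ↦ betaOfRecord₁₃ F 2 θ.toStage13Params k 0⃗` · `bOwn_eq_βfun_apply_zero` (`rfl` at the datum) · `bOwn_eq_beta0OfMerged` (= the inline object) ·
  `split_β0_eq_bOwn` ∕ `split_β0_eq_bOwn'` (every split of the record's β reads `bOwn`) · `βfun_of_notMem_box` · `tendsto_bOwn` (under `Beta0LimitExists`, `bOwn k` IS the `g_k → 0⁺`
  limit at `θ.v₀ k`) · `endpointExistence_of_chainTFac190H_bOwnDrift` (an4's box edition at ANY split reads a drift of `bOwn`).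
* §2 `RunChain190At F θ hP b s` — p606097 §2's one text with the drift REMOVED and `(b, s)` made PARAMETERS: the run-wise (190)-chain of the record's β relative to `b` (rows (D4) ∧ B4
  = NODE O), side conditions, `0 < γ₀`, cap `ε₁·K_rem,L ≤ s`, (C) on survivors · `RunChain190At.mono` (cap monotone in `s`) · `endpointExistence_of_runChain190At_drift` ·
  ★ `oneText_iff` (p606097's per-tuple text ⟺ `∃ b s, RunChain190At … b s ∧ ∃ A, OneLoopDrift s A b` — the predicate IS its `(b, s)`-section, nothing re-typed).
* §3 THE (β3) TEXTS: `sOwn F θ := θ.cβ · stepBal 2 F.L` (`sOwn_pos` under admissibility) · 2ᴼᴰ `OwnNumbersDriftAt σ` («prefix → ∃ s ≥ σ F θ, ∃ A, OneLoopDrift s A (bOwn F θ)», slope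
  FLOOR keying) · 1ᴼᴿ `RunChain190AtOwnNumbersAt σ` («prefix → RunChain190At F θ hP (bOwn F θ) (σ F θ)») · closed texts `OwnNumbersDrift` ∕ `RunChain190AtOwnNumbers` (`σ := sOwn`) ·
  ★★ `EndpointGivenBR13SepCoPH_of_ownNumbersAt σ` ∕ ★★ `EndpointGivenBR13SepCoPH_of_ownNumbers` (THE PAIR ⟹ THE CRUX DECL BY NAME) · `ownDriftRunChain190K_of_ownNumbersAt` (the pair ⟹
  p606097's one text VERBATIM: it IS a split of it along the identity `b := bOwn`) · use forms `ownNumbersDriftAt_of_adm`, `ownNumbersDriftAt_anti`, `runChain190AtOwnNumbersAt_mono`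
  (the dial `σ` trades difficulty between the two cells in OPPOSITE directions) · ★ `ownNumbersDriftAt_of_geometricLimit` (2ᴼᴰ at floor `σ` ⟸ (AF-0r) for `bOwn` — N17's conclusion
  SHAPE at the record — ∧ the FLOOR `σ F θ ≤ b_∞`: what 2ᴼᴰ costs beyond N17 is ONE real inequality per tuple on the record's limiting own one-loop number).
* §3b THE DRIFT-KEYED SEAM (row-D4 owner an4's reading, bus l.29930 (B)): 2ᴼᴰ⁺ `OwnNumbersDriftPos` («∃ s A, 0 < s ∧ OneLoopDrift s A (bOwn F θ)» — drift + SIGN only, no `stepBal`) ·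
  1ᴼᴿ⁺ `RunChain190AtOwnDriftSlope` («∀ s A, 0 < s → OneLoopDrift s A (bOwn F θ) → RunChain190At … (bOwn F θ) s» — NODE O's cap against the given slope) · ★★
  `EndpointGivenBR13SepCoPH_of_ownNumbersDriftKeyed` · `ownDriftRunChain190K_of_ownNumbersDriftKeyed` · bridges `ownNumbersDriftPos_of_driftAt` ∕ `_of_ownNumbersDrift`,
  `runChain190AtOwnNumbersAt_of_driftSlope` (how the two keyings meet).  THE PLAN PICKS THE SEAM (σ-keyed at a σ it names, or drift-keyed); every option composes BY NAME.

HONEST FRAMING.  Definitions and elementary bookkeeping; NOTHING of Bałaban's analysis is asserted; no stub is proved; (β3) is a BOOKING of plan g83 (WORDS-4), NOT a registered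
skeleton — the skeleton of record is v6 `5a75a2378c79b303` {`stub_d1AnchoredJets13`, `stub_runRemNamedJets13`} (2 registered, 0 closed) and this file neither replaces nor
re-registers it; K2⁷ stmt-QuantumFields-20543 OPEN; (D1) ∕ (D4) NOT discharged at any tuple; `Beta0LimitExists` ∕ (AF-0r) ∕ the floor NOT proved anywhere here; counts unmoved
(typed 28∕28 · discharged 5∕27).  [I] Thm 2 + (0.31) p. 259 (NODE O) is UNPROVED IN PRINT.  Route R4 closes the CONDITIONAL finite-𝕋⁴ rung `BalabanLadder.UV` only — one finite
𝕋⁴ at fixed `ε = L^{−K}`: NOT the continuum limit, NOT ℝ⁴, NOT OS, NOT a mass gap, NOT Clay; the Yang–Mills mass gap is NOT proved by any of this.  Sources (context only; nothing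
printed is used as a hypothesis): [I] Thm 2 p. 259 (first sentence), (1.3) p. 260, Thm 3 + (1.20)–(1.22) p. 264, (2.12)–(2.14) p. 268, (5.10) p. 293; [II] Lemma 3 (2.38) p. 20.
-/

noncomputable section

open scoped Matrix.Norms.L2Operator

namespace Summit.QuantumFields.YangMills.Theorems.BalabanUVNodesK2OwnNumbersDefs

open Filter
open Literature.MathematicalPhysics.QuantumFieldTheory.Balaban1983to89
open Literature.MathematicalPhysics.QuantumFieldTheory.Balaban1983to89.FlowStep
open Literature.MathematicalPhysics.QuantumFieldTheory.Balaban1983to89.B12Beta (HistBox OneLoopSplit)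
open Literature.MathematicalPhysics.QuantumFieldTheory.Balaban1983to89.B13ScaleTransfer (Pt)
open Literature.MathematicalPhysics.QuantumFieldTheory.Balaban1983to89.DagBinding (EndpointExistence)
open Literature.MathematicalPhysics.QuantumFieldTheory.Balaban1983to89.T4Continuum (T4Family)
open Literature.MathematicalPhysics.QuantumFieldTheory.Balaban1983to89.Beta.Drift (OneLoopDrift drift_of_geometric)
open Literature.MathematicalPhysics.QuantumFieldTheory.Balaban1983to89.Beta.RemainderChainLattice
open Literature.MathematicalPhysics.QuantumFieldTheory.Balaban1983to89.Beta.RemainderLimitTorus (LDom limKernel)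
open Literature.MathematicalPhysics.QuantumFieldTheory.Balaban1983to89.Beta.RemainderLocalityHolo
open Literature.MathematicalPhysics.QuantumFieldTheory.Balaban1983to89.Beta.RemainderDecay190
open Literature.MathematicalPhysics.QuantumFieldTheory.Balaban1983to89.Beta.RemainderDecay190HoloChain
open Summit.QuantumFields.BalabanUV.Gaps.BetaContFromD4Chain (CPt)
open Summit.QuantumFields.YangMills.Theorems.BalabanUVNodesK2JsOfRecord (StepColourData beta0OfJs stepBal_L_pos)
open Summit.QuantumFields.YangMills.Theorems.BalabanUVNodesK2NamedJetsRunRemAt (SurvCont)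
open Summit.QuantumFields.YangMills.Theorems.BalabanUVNodesK2EndOfChain190OwnDrift (endpointExistence_of_runLeaves190H_ownDrift
  endpointExistence_of_chainTFac190H_ownDrift)
open Summit.QuantumFields.YangMills.Theorems.BalabanUVNodesK2V6Defs (Window13)
open Summit.QuantumFields.YangMills.Theorems.EndpointGivenBR13SepCoPH.Negative.Anchor13FalseOfTwoBaseHistories (split_β0_eq_apply_zero)

/-! ## §1 NODE O's OWN one-loop numbers at the Stage-13 record, BY NAME -/

/-- **`bOwn F θ` — THE RECORD's OWN ONE-LOOP NUMBERS at Stage-13 parameters**: the β-functions of record `Node00.betaOfRecord₁₃ F 2 θ.toStage13Params` READ AT THE ZERO HISTORY,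
`k ↦ β_{k+1}(0, …, 0)`.  By the box convention of `Node00.betaOfMerged` this IS the record's one-loop number object `Node00.beta0OfMerged βm θ.v₀` (`bOwn_eq_beta0OfMerged`: the
`limUnder (𝓝[>] 0)` of the merged β along the last coupling at the base histories `θ.v₀`), and it is the `β0` field of EVERY `OneLoopSplit` of the record's β (`split_β0_eq_bOwn`).
`hP`-free and history-free BY TYPING.  LOCATED CAVEAT (file header): junk unless `Node00.Beta0LimitExists βm θ.v₀`; `θ.v₀` is read by no admissibility clause; existence ∕
history-independence ∕ sign are N17 ∕ NODE O ∕ β-cell statements — a definition asserting nothing.  (Plan g83 (q-K2-3)'s `bOwn`; [I] (2.12)–(2.14) p. 268 «β = β⁰ + β¹, β¹ vanishes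
at g_k = 0» is the printed reading this object models.) [folklore] -/
def bOwn (F : T4Family) (θ : Node00.Stage13HParams F 2) : ℕ → ℝ :=
  fun k => Node00.betaOfRecord₁₃ F 2 θ.toStage13Params k (fun _ => 0)

section Own
variable (F : T4Family) (θ : Node00.Stage13HParams F 2) (hP : θ.Provisos₁₃SepCoPH F 2)

/-- AT THE DATUM: `bOwn F θ k` IS the Stage-13 datum's β at the zero history (`Node00.βfun_datumOfRecord₁₃SepCoPH` is `rfl`; `hP` is a phantom binder). [folklore] -/
theorem bOwn_eq_βfun_apply_zero (k : ℕ) : bOwn F θ k = (Node00.datumOfRecord₁₃SepCoPH F 2 θ hP).βfun k (fun _ => 0) := rfl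

/-- **`bOwn` IS THE RECORD's ONE-LOOP NUMBER OBJECT** `beta0OfMerged βm θ.v₀` of `Node00/BetaOfRecord.lean` design (β) — the inline term of `…N26AtRecord13Core` ∕ `…K2StubD4FlatSlope` ∕
`…N17AtRecord13Sep` — because the zero history is OFF the box `]0, θ.γ]^{k+1}` (`Node00.betaOfMerged_of_notMem`; = CRIT-2's `βfun_apply_zero` read `hP`-free).
[cite: Balaban1987RG1, (1.22) p.264 and (2.12)–(2.14) p.268 (bookkeeping)] -/
theorem bOwn_eq_beta0OfMerged :
    letI := θ.instVβ₁; letI := θ.instVβ₂; letI := θ.instιβ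
    bOwn F θ = Node00.beta0OfMerged
      (Node00.betaMerged F (Node00.mergedTermFamilyMatT F 2 (Node00.TcanOfRecord F 2) (Node00.chiFixed29 F 2 θ.ν θ.ε₂₉) θ.εbg) θ.ρ8 θ.bV) θ.v₀ :=
  funext fun k => Node00.betaOfMerged_of_notMem _ _ _ fun hmem => lt_irrefl (0 : ℝ) ((mem_box.mp hmem) (Fin.last k)).1

/-- **EVERY ONE-LOOP SPLIT OF THE RECORD's β READS `bOwn`**: `S.β0 = bOwn F θ` for every `S : OneLoopSplit (betaOfRecord₁₃ F 2 θ.toStage13Params)` (an4's `split_β0_eq_apply_zero`: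
`split` + `vanish` at the zero history) — «NODE O's own numbers» is not a choice. [folklore] -/
theorem split_β0_eq_bOwn (S : OneLoopSplit (Node00.betaOfRecord₁₃ F 2 θ.toStage13Params)) : S.β0 = bOwn F θ :=
  funext fun k => split_β0_eq_apply_zero S k

/-- … the same for splits of the DATUM's β (the type an4's box edition `endpointExistence_of_chainTFac190H_ownDrift` quantifies over). [folklore] -/
theorem split_β0_eq_bOwn' (S : OneLoopSplit (Node00.datumOfRecord₁₃SepCoPH F 2 θ hP).βfun) : S.β0 = bOwn F θ :=
  funext fun k => split_β0_eq_apply_zero S k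

/-- OFF THE BOX OF RECORD the datum's β IS `bOwn` (box convention), at every history with a non-positive or `> θ.γ` entry. [cite: Balaban1987RG1, (2.12)–(2.14) p.268 (bookkeeping)] -/
theorem βfun_of_notMem_box {k : ℕ} {v : Fin (k + 1) → ℝ} (hv : v ∉ Box θ.γ k) :
    (Node00.datumOfRecord₁₃SepCoPH F 2 θ hP).βfun k v = bOwn F θ k :=
  have h0 : (fun _ : Fin (k + 1) => (0 : ℝ)) ∉ Box θ.γ k := fun hmem => lt_irrefl (0 : ℝ) ((mem_box.mp hmem) (Fin.last k)).1
  (Node00.betaOfMerged_of_notMem _ _ _ hv).trans (Node00.betaOfMerged_of_notMem _ _ _ h0).symm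

/-- **WHAT `bOwn` IS, HONESTLY — the `limUnder` reading**: under the NAMED existence clause `Node00.Beta0LimitExists βm θ.v₀` ([I] p. 268 «vanishes at g_k = 0» read as a one-sided
limit; an ESTIMATE, never asserted here), `bOwn F θ k` IS the limit of the merged β as the last coupling `g → 0⁺` at the base history `θ.v₀ k` (`Node00.tendsto_beta0OfMerged` BY NAME).
Without that clause the value is `limUnder`'s junk. [cite: Balaban1987RG1, (2.12)–(2.14) p.268] -/
theorem tendsto_bOwn
    (h : letI := θ.instVβ₁; letI := θ.instVβ₂; letI := θ.instιβ
      Node00.Beta0LimitExists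
        (Node00.betaMerged F (Node00.mergedTermFamilyMatT F 2 (Node00.TcanOfRecord F 2) (Node00.chiFixed29 F 2 θ.ν θ.ε₂₉) θ.εbg) θ.ρ8 θ.bV) θ.v₀)
    (k : ℕ) :
    letI := θ.instVβ₁; letI := θ.instVβ₂; letI := θ.instιβ
    Tendsto (fun g : ℝ =>
        Node00.betaMerged F (Node00.mergedTermFamilyMatT F 2 (Node00.TcanOfRecord F 2) (Node00.chiFixed29 F 2 θ.ν θ.ε₂₉) θ.εbg) θ.ρ8 θ.bV k
          (Function.update (θ.v₀ k) (Fin.last k) g))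
      (nhdsWithin (0 : ℝ) (Set.Ioi 0)) (nhds (bOwn F θ k)) := by
  letI := θ.instVβ₁; letI := θ.instVβ₂; letI := θ.instιβ
  rw [bOwn_eq_beta0OfMerged F θ]
  exact Node00.tendsto_beta0OfMerged _ _ h k

/-- **AN4's BOX EDITION READS `bOwn` AT EVERY SPLIT**: `…K2EndOfChain190OwnDrift.endpointExistence_of_chainTFac190H_ownDrift` for ANY split `Sβ` of the datum's β with the drift
hypothesis stated on `bOwn F θ` (rewrite `Sβ.β0 = bOwn F θ`).  CONDITIONAL bookkeeping; nothing asserted. [cite: Balaban1987RG1, Thm 2 p.259 (first sentence), (1.22) p.264; Balaban1988RG2Cluster, Lemma 3 (2.38) p.20] -/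
theorem endpointExistence_of_chainTFac190H_bOwnDrift {M : ℕ} [NeZero M] {μ ν : Fin 4} {c : B13.Consts} {ℓ α₂ : ℝ} {q : Consts190} {γ₀ s A : ℝ}
    (Sβ : OneLoopSplit (Node00.datumOfRecord₁₃SepCoPH F 2 θ hP).βfun) (R : ChainTFac190H 4 M μ ν Sβ γ₀ c ℓ α₂ q) (hcpt : CPt R)
    (hC : CondsL 4 c ℓ) (h22 : c.R22gen ℓ) (hq : q.Valid c.δ₀) (hs : SignsL c α₂ q.B₃) (hγ₀ : 0 < γ₀)
    (hdrift : OneLoopDrift s A (bOwn F θ)) (hcap : c.ε₁ * remCoeffL 4 M c α₂ q.B₃ ≤ s) :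
    EndpointExistence (Node00.datumOfRecord₁₃SepCoPH F 2 θ hP).C.toB12 :=
  endpointExistence_of_chainTFac190H_ownDrift F θ hP Sβ R hcpt hC h22 hq hs hγ₀ ((split_β0_eq_bOwn' F θ hP Sβ).symm ▸ hdrift) hcap

end Own

/-! ## §2 The run-wise (190)-chain of the record relative to a NAMED reference sequence `b`, with cap `s` (p606097's one text, drift removed, `(b, s)` parameters) -/

section Chain
variable (F : T4Family) (θ : Node00.Stage13HParams F 2) (hP : θ.Provisos₁₃SepCoPH F 2)

/-- HYPOTHESIS SHAPE (never a fact): **THE RUN-WISE (190)-CHAIN OF THE RECORD RELATIVE TO `b` WITH CAP `s`** — SOME chain data `(M, μ, ν, c, ℓ, α₂, q, γ₀)` such that at every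
prefix of every in-window run of the datum's construction (`RGEqH n β gs ∧ Step.InInterval γ₀ n gs`, `k ≤ n`) the remainder `β_{k+1}(g_0,…,g_k) − b_k` is the second moment of a
limiting kernel carrying the (190)-leaves (rows (D4) ∧ B4 of record = NODE O: [II] (2.38) → [I] (5.10) → (1.22)), with [II]'s side conditions, `0 < γ₀`, the CAP `ε₁·K_rem,L ≤ s` and
(C) on the survivor sets.  = the hypothesis family of `…K2EndOfChain190OwnDrift.EndpointGivenBR13SepCoPH_of_ownDriftRunChain190K` (p606097 §2) with the drift conjunct REMOVED and
`(b, s)` made parameters (`oneText_iff`).  A predicate over `(F, θ, hP, b, s)`; instance 0∕1; print context [I] Thm 2 p. 259 (unproved in print), Thm 3 p. 264. [folklore] -/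
def RunChain190At (b : ℕ → ℝ) (s : ℝ) : Prop :=
  ∃ (M : ℕ) (_ : NeZero M) (μ ν : Fin 4) (c : B13.Consts) (ℓ α₂ : ℝ) (q : Consts190) (γ₀ : ℝ),
    (∀ (n : ℕ) (gs : ℕ → ℝ), RGEqH n (Node00.datumOfRecord₁₃SepCoPH F 2 θ hP).βfun gs → Step.InInterval γ₀ n gs → ∀ k, k ≤ n →
      ∃ a : LDom 4 → Pt 4 → ℝ, (Node00.datumOfRecord₁₃SepCoPH F 2 θ hP).βfun k (prefixOf gs k) - b k =
        B12Beta.secondMoment (fun _ _ => limKernel a) μ ν ∧ Nonempty (PolLeavesTFac190H 4 M a c ℓ α₂ q)) ∧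
    CondsL 4 c ℓ ∧ c.R22gen ℓ ∧ q.Valid c.δ₀ ∧ SignsL c α₂ q.B₃ ∧ 0 < γ₀ ∧
    c.ε₁ * remCoeffL 4 M c α₂ q.B₃ ≤ s ∧ SurvCont (Node00.datumOfRecord₁₃SepCoPH F 2 θ hP).βfun γ₀

variable {F θ hP} in
/-- The cap is MONOTONE in `s`: a chain with cap `≤ s` is a chain with cap `≤ s′` for every `s ≤ s′`. [folklore] -/
theorem RunChain190At.mono {b : ℕ → ℝ} {s s' : ℝ} (h : RunChain190At F θ hP b s) (hle : s ≤ s') : RunChain190At F θ hP b s' := by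
  obtain ⟨M, iM, μ, ν, c, ℓ, α₂, q, γ₀, hrun, hC, h22, hq, hs, hγ₀, hcap, hcont⟩ := h
  exact ⟨M, iM, μ, ν, c, ℓ, α₂, q, γ₀, hrun, hC, h22, hq, hs, hγ₀, hcap.trans hle, hcont⟩

/-- **CHAIN relative to `b` with cap `s` + a DRIFT of the SAME `b` with slope `s` ⟹ `EndpointExistence`** at the datum (p606097's `endpointExistence_of_runLeaves190H_ownDrift` BY NAME).
CONDITIONAL; nothing of Bałaban asserted. [cite: Balaban1987RG1, Thm 2 p.259 (first sentence), Thm 3 p.264, (2.12)–(2.14) p.268 and (5.10) p.293; Balaban1988RG2Cluster, Lemma 3 (2.38) p.20] -/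
theorem endpointExistence_of_runChain190At_drift {b : ℕ → ℝ} {s A : ℝ} (h : RunChain190At F θ hP b s) (hd : OneLoopDrift s A b) :
    EndpointExistence (Node00.datumOfRecord₁₃SepCoPH F 2 θ hP).C.toB12 := by
  obtain ⟨M, iM, μ, ν, c, ℓ, α₂, q, γ₀, hrun, hC, h22, hq, hs, hγ₀, hcap, hcont⟩ := h
  exact endpointExistence_of_runLeaves190H_ownDrift F θ hP hrun hC h22 hq hs hγ₀ hd hcap hcont

/-- **★ `RunChain190At` IS THE `(b, s)`-SECTION OF p606097's ONE TEXT, VERBATIM**: at a tuple, the hypothesis body of `EndpointGivenBR13SepCoPH_of_ownDriftRunChain190K` holds iff SOME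
`(b, s)` carries the chain with cap `s` AND a drift of `b` with slope `s` (reordering of `∃`; nothing re-typed).  So any NAMING of `b` (and `s`) splits the one text into exactly two
pieces — the chain at the name, the drift at the name. [folklore] -/
theorem oneText_iff :
    (∃ (b : ℕ → ℝ) (s A : ℝ) (M : ℕ) (_ : NeZero M) (μ ν : Fin 4) (c : B13.Consts) (ℓ α₂ : ℝ) (q : Consts190) (γ₀ : ℝ),
        (∀ (n : ℕ) (gs : ℕ → ℝ), RGEqH n (Node00.datumOfRecord₁₃SepCoPH F 2 θ hP).βfun gs → Step.InInterval γ₀ n gs → ∀ k, k ≤ n →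
          ∃ a : LDom 4 → Pt 4 → ℝ, (Node00.datumOfRecord₁₃SepCoPH F 2 θ hP).βfun k (prefixOf gs k) - b k =
            B12Beta.secondMoment (fun _ _ => limKernel a) μ ν ∧ Nonempty (PolLeavesTFac190H 4 M a c ℓ α₂ q)) ∧
        CondsL 4 c ℓ ∧ c.R22gen ℓ ∧ q.Valid c.δ₀ ∧ SignsL c α₂ q.B₃ ∧ 0 < γ₀ ∧
        c.ε₁ * remCoeffL 4 M c α₂ q.B₃ ≤ s ∧ OneLoopDrift s A b ∧
        SurvCont (Node00.datumOfRecord₁₃SepCoPH F 2 θ hP).βfun γ₀) ↔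
      ∃ (b : ℕ → ℝ) (s : ℝ), RunChain190At F θ hP b s ∧ ∃ A : ℝ, OneLoopDrift s A b := by
  constructor
  · rintro ⟨b, s, A, M, iM, μ, ν, c, ℓ, α₂, q, γ₀, hrun, hC, h22, hq, hs, hγ₀, hcap, hd, hcont⟩
    exact ⟨b, s, ⟨M, iM, μ, ν, c, ℓ, α₂, q, γ₀, hrun, hC, h22, hq, hs, hγ₀, hcap, hcont⟩, A, hd⟩
  · rintro ⟨b, s, ⟨M, iM, μ, ν, c, ℓ, α₂, q, γ₀, hrun, hC, h22, hq, hs, hγ₀, hcap, hcont⟩, A, hd⟩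
    exact ⟨b, s, A, M, iM, μ, ν, c, ℓ, α₂, q, γ₀, hrun, hC, h22, hq, hs, hγ₀, hcap, hd, hcont⟩

end Chain

/-! ## §3 Plan g83's booking (β3) as TWO TEXTS BY NAME: 1ᴼᴿ the chain AT `bOwn`, 2ᴼᴰ the drift OF `bOwn` (slope floor `σ`), and the composition to the crux decl -/

section Beta3
/-- **`sOwn F θ := θ.cβ · stepBal 2 F.L` — THE SLOPE LETTER OF RECORD** (plan g83's `s⋆`): print's one-loop asymptotic-freedom coefficient `b₀(L)` ([I] (1.3) p. 260) in the record's
normalisation `θ.cβ` (the chart constant the β of record is degree-1 homogeneous in; = v6's cap letter `s ≤ θ.cβ·stepBal 2 F.L` of `RunRemAt`, and the slope `ownDriftRunChain190K_of_…`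
of p606097 §3 gives v6's pair).  A sub-cell convention constant `c⋆ ≠ 1`, if ever named, would put `θ.cβ / c⋆` (one token).  A definition asserting nothing. [folklore] -/
def sOwn (F : T4Family) (θ : Node00.Stage13HParams F 2) : ℝ :=
  θ.cβ * B12Normalization.stepBal 2 F.L

/-- At an ADMISSIBLE tuple the slope letter is positive (`0 < θ.cβ` is Stage-9 admissibility's chart clause; `0 < stepBal 2 F.L` since `1 < F.L`, `…K2JsOfRecord.stepBal_L_pos`). [folklore] -/
theorem sOwn_pos (F : T4Family) (θ : Node00.Stage13HParams F 2) (hθ : θ.Admissible F 2) : 0 < sOwn F θ :=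
  mul_pos hθ.toStage9.chart.1 (stepBal_L_pos F two_pos)

/-- **TEXT 2ᴼᴰ (slope-FLOOR keying `σ`): «THE RECORD's OWN ONE-LOOP NUMBERS DRIFT WITH SLOPE AT LEAST `σ F θ`»** — at every tuple carrying the crux's prefix (unity guard, admissibility,
(B), window): `∃ s A, σ F θ ≤ s ∧ OneLoopDrift s A (bOwn F θ)` (row (D1) READ AT NODE O's OWN `limUnder` NUMBERS: cumulative drift `|Σ_{j<k} bOwn_j − s·k| ≤ A`; the floor is what the
chain's cap is stated against).  HYPOTHESIS SHAPE ∕ obligation text, never a fact; θ-dependent by nature (`bOwn` reads every Stage-13 parameter); see `ownNumbersDriftAt_of_geometricLimit`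
for what it costs beyond N17's (AF-0r).  Smaller `σ` = weaker text (`ownNumbersDriftAt_anti`). [folklore] -/
def OwnNumbersDriftAt (σ : (F : T4Family) → Node00.Stage13HParams F 2 → ℝ) : Prop :=
  ∀ (F : T4Family) (θ : Node00.Stage13HParams F 2) (hP : θ.Provisos₁₃SepCoPH F 2), (θ.ZhUnity F 2 ∧ θ.SlotsNondegenerate₁₃ F 2) → θ.Admissible F 2 →
    B16.EndStatementBPrinted (Node00.datumOfRecord₁₃SepCoPH F 2 θ hP).C → Window13 F θ hP →
    ∃ s A : ℝ, σ F θ ≤ s ∧ OneLoopDrift s A (bOwn F θ)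

/-- **TEXT 1ᴼᴿ (cap keying `σ`): «THE RUN-WISE (190)-CHAIN OF THE RECORD RELATIVE TO ITS OWN ONE-LOOP NUMBERS, CAP `≤ σ F θ`»** — at every tuple carrying the crux's prefix:
`RunChain190At F θ hP (bOwn F θ) (σ F θ)` (NODE O's wall on print's road: [II] (2.38) → [I] (5.10) → (1.22) along the in-window runs, the remainder taken relative to the record's OWN
numbers — no named jets, no κ, no anchor, no `θ.γ` bound).  HYPOTHESIS SHAPE ∕ obligation text, never a fact; size XL (= NODE O, [I] Thm 2 p. 259 unproved in print; instance 0∕1).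
Larger `σ` = weaker text (`runChain190AtOwnNumbersAt_mono`). [folklore] -/
def RunChain190AtOwnNumbersAt (σ : (F : T4Family) → Node00.Stage13HParams F 2 → ℝ) : Prop :=
  ∀ (F : T4Family) (θ : Node00.Stage13HParams F 2) (hP : θ.Provisos₁₃SepCoPH F 2), (θ.ZhUnity F 2 ∧ θ.SlotsNondegenerate₁₃ F 2) → θ.Admissible F 2 →
    B16.EndStatementBPrinted (Node00.datumOfRecord₁₃SepCoPH F 2 θ hP).C → Window13 F θ hP →
    RunChain190At F θ hP (bOwn F θ) (σ F θ)

/-- **TEXT 2ᴼᴰ AT THE SLOPE LETTER OF RECORD**: `OwnNumbersDriftAt sOwn` — the record's own numbers drift with slope `≥ θ.cβ · stepBal 2 F.L` (print's value; the largest honest floor).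
Obligation text, never a fact. [folklore] -/
def OwnNumbersDrift : Prop := OwnNumbersDriftAt sOwn

/-- **TEXT 1ᴼᴿ AT THE SLOPE LETTER OF RECORD**: `RunChain190AtOwnNumbersAt sOwn` — the chain relative to `bOwn` with cap `ε₁·K_rem,L ≤ θ.cβ · stepBal 2 F.L` (v6's cap letter).
Obligation text, never a fact; size XL (NODE O). [folklore] -/
def RunChain190AtOwnNumbers : Prop := RunChain190AtOwnNumbersAt sOwn

/-- `OwnNumbersDrift` unfolds to the floor-keyed text at `sOwn` (`Iff.rfl`). [folklore] -/
theorem ownNumbersDrift_iff : OwnNumbersDrift ↔ OwnNumbersDriftAt sOwn := Iff.rfl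

/-- `RunChain190AtOwnNumbers` unfolds to the cap-keyed text at `sOwn` (`Iff.rfl`). [folklore] -/
theorem runChain190AtOwnNumbers_iff : RunChain190AtOwnNumbers ↔ RunChain190AtOwnNumbersAt sOwn := Iff.rfl

/-- **★★ THE (β3) PAIR ⟹ THE CRUX DECL BY NAME, at any common dial `σ`** (`Summit.QuantumFields.YangMills.Theses.BalabanUVNodes.EndpointGivenBR13SepCoPH`): per tuple, 2ᴼᴰ gives a drift
of `bOwn F θ` with slope `s ≥ σ F θ`, 1ᴼᴿ the chain relative to `bOwn F θ` with cap `≤ σ F θ ≤ s` (`RunChain190At.mono`), and p606097's END concludes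
(`endpointExistence_of_runChain190At_drift`).  So a registered v7 `{stub_ownDrift13 : OwnNumbersDriftAt σ, stub_runChainOwn13 : RunChain190AtOwnNumbersAt σ}` closes sorry-free by
`EndpointGivenBR13SepCoPH_of_ownNumbersAt σ stub_ownDrift13 stub_runChainOwn13`.  CONDITIONAL on the two displayed texts; K2⁷ NOT closed; nothing of Bałaban asserted.
[cite: Balaban1987RG1, Thm 2 p.259 (first sentence), Thm 3 p.264, (2.12)–(2.14) p.268 and (5.10) p.293; Balaban1988RG2Cluster, Lemma 3 (2.38) p.20] -/
theorem EndpointGivenBR13SepCoPH_of_ownNumbersAt (σ : (F : T4Family) → Node00.Stage13HParams F 2 → ℝ)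
    (h₁ : OwnNumbersDriftAt σ) (h₂ : RunChain190AtOwnNumbersAt σ) :
    Summit.QuantumFields.YangMills.Theses.BalabanUVNodes.EndpointGivenBR13SepCoPH := by
  intro F θ hP hU hθ hB hwin
  obtain ⟨s, A, hle, hd⟩ := h₁ F θ hP hU hθ hB hwin
  exact endpointExistence_of_runChain190At_drift F θ hP ((h₂ F θ hP hU hθ hB hwin).mono hle) hd

/-- **★★ THE (β3) PAIR AT THE SLOPE LETTER OF RECORD ⟹ THE CRUX DECL BY NAME**: `OwnNumbersDrift → RunChain190AtOwnNumbers → EndpointGivenBR13SepCoPH`.  CONDITIONAL; K2⁷ NOT closed.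
[cite: Balaban1987RG1, Thm 2 p.259 (first sentence), (1.3) p.260, (2.12)–(2.14) p.268 and (5.10) p.293] -/
theorem EndpointGivenBR13SepCoPH_of_ownNumbers (h₁ : OwnNumbersDrift) (h₂ : RunChain190AtOwnNumbers) :
    Summit.QuantumFields.YangMills.Theses.BalabanUVNodes.EndpointGivenBR13SepCoPH :=
  EndpointGivenBR13SepCoPH_of_ownNumbersAt sOwn h₁ h₂

/-- **THE PAIR ⟹ p606097's ONE TEXT, VERBATIM** (the hypothesis of `…K2EndOfChain190OwnDrift.EndpointGivenBR13SepCoPH_of_ownDriftRunChain190K`): witness `b := bOwn F θ`, the drift's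
slope `s`, the chain's data with its cap weakened to `s`.  So {1ᴼᴿ, 2ᴼᴰ} IS a split of the one text along the identity of `b` — the special case «`b` is the record's own zero-history
numbers», exactly as v6's pair is the special case «`b := θ.cβ • beta0OfJs F κ`» (p606097 §3); never conversely. [folklore] -/
theorem ownDriftRunChain190K_of_ownNumbersAt (σ : (F : T4Family) → Node00.Stage13HParams F 2 → ℝ)
    (h₁ : OwnNumbersDriftAt σ) (h₂ : RunChain190AtOwnNumbersAt σ) :
    ∀ (F : T4Family) (θ : Node00.Stage13HParams F 2) (hP : θ.Provisos₁₃SepCoPH F 2),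
      (θ.ZhUnity F 2 ∧ θ.SlotsNondegenerate₁₃ F 2) → θ.Admissible F 2 →
      B16.EndStatementBPrinted (Node00.datumOfRecord₁₃SepCoPH F 2 θ hP).C →
      (∃ γ₁ : ℝ, 0 < γ₁ ∧ ∀ γ : ℝ, 0 < γ → γ ≤ γ₁ →
        ∃ P : B12.RunParams, 1 ≤ P.K ∧ ((Node00.datumOfRecord₁₃SepCoPH F 2 θ hP).C P).flow.InInterval γ P.K) →
      ∃ (b : ℕ → ℝ) (s A : ℝ) (M : ℕ) (_ : NeZero M) (μ ν : Fin 4) (c : B13.Consts) (ℓ α₂ : ℝ) (q : Consts190) (γ₀ : ℝ),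
        (∀ (n : ℕ) (gs : ℕ → ℝ), RGEqH n (Node00.datumOfRecord₁₃SepCoPH F 2 θ hP).βfun gs → Step.InInterval γ₀ n gs → ∀ k, k ≤ n →
          ∃ a : LDom 4 → Pt 4 → ℝ, (Node00.datumOfRecord₁₃SepCoPH F 2 θ hP).βfun k (prefixOf gs k) - b k =
            B12Beta.secondMoment (fun _ _ => limKernel a) μ ν ∧ Nonempty (PolLeavesTFac190H 4 M a c ℓ α₂ q)) ∧
        CondsL 4 c ℓ ∧ c.R22gen ℓ ∧ q.Valid c.δ₀ ∧ SignsL c α₂ q.B₃ ∧ 0 < γ₀ ∧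
        c.ε₁ * remCoeffL 4 M c α₂ q.B₃ ≤ s ∧ OneLoopDrift s A b ∧
        SurvCont (Node00.datumOfRecord₁₃SepCoPH F 2 θ hP).βfun γ₀ := by
  intro F θ hP hU hθ hB hwin
  obtain ⟨s, A, hle, hd⟩ := h₁ F θ hP hU hθ hB hwin
  obtain ⟨M, iM, μ, ν, c, ℓ, α₂, q, γ₀, hrun, hC, h22, hq, hs, hγ₀, hcap, hcont⟩ := h₂ F θ hP hU hθ hB hwin
  exact ⟨bOwn F θ, s, A, M, iM, μ, ν, c, ℓ, α₂, q, γ₀, hrun, hC, h22, hq, hs, hγ₀, hcap.trans hle, hd, hcont⟩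

/-- USE FORM for 2ᴼᴰ, keyed on admissibility alone (the extra antecedents of the registered-shape text are discarded): a θ-wise drift of `bOwn` with slope `≥ σ F θ` at every admissible
Stage-13 tuple ⟹ `OwnNumbersDriftAt σ`. [folklore] -/
theorem ownNumbersDriftAt_of_adm (σ : (F : T4Family) → Node00.Stage13HParams F 2 → ℝ)
    (h : ∀ (F : T4Family) (θ : Node00.Stage13HParams F 2), θ.Admissible F 2 → ∃ s A : ℝ, σ F θ ≤ s ∧ OneLoopDrift s A (bOwn F θ)) :
    OwnNumbersDriftAt σ :=
  fun F θ _ _ hθ _ _ => h F θ hθ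

/-- USE FORM for 2ᴼᴰ at the EXACT slope: a drift of `bOwn F θ` with slope exactly `σ F θ` under the prefix ⟹ `OwnNumbersDriftAt σ` (floor `le_rfl`). [folklore] -/
theorem ownNumbersDriftAt_of_exact (σ : (F : T4Family) → Node00.Stage13HParams F 2 → ℝ)
    (h : ∀ (F : T4Family) (θ : Node00.Stage13HParams F 2) (hP : θ.Provisos₁₃SepCoPH F 2), (θ.ZhUnity F 2 ∧ θ.SlotsNondegenerate₁₃ F 2) → θ.Admissible F 2 →
      B16.EndStatementBPrinted (Node00.datumOfRecord₁₃SepCoPH F 2 θ hP).C → Window13 F θ hP → ∃ A : ℝ, OneLoopDrift (σ F θ) A (bOwn F θ)) :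
    OwnNumbersDriftAt σ := fun F θ hP hU hθ hB hwin => by
  obtain ⟨A, hd⟩ := h F θ hP hU hθ hB hwin
  exact ⟨σ F θ, A, le_rfl, hd⟩

/-- THE DIAL, β SIDE: 2ᴼᴰ is ANTITONE in the floor — lowering `σ` weakens the drift text. [folklore] -/
theorem ownNumbersDriftAt_anti {σ σ' : (F : T4Family) → Node00.Stage13HParams F 2 → ℝ} (hle : ∀ F θ, σ' F θ ≤ σ F θ) (h : OwnNumbersDriftAt σ) :
    OwnNumbersDriftAt σ' := fun F θ hP hU hθ hB hwin => by
  obtain ⟨s, A, hs, hd⟩ := h F θ hP hU hθ hB hwin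
  exact ⟨s, A, (hle F θ).trans hs, hd⟩

/-- THE DIAL, NODE O SIDE: 1ᴼᴿ is MONOTONE in the cap — raising `σ` weakens the chain text.  (So the one dial `σ` trades difficulty between the β cell and NODE O in OPPOSITE directions;
`sOwn` — the true slope on print's road — is the largest floor 2ᴼᴰ can honestly carry, hence the easiest cap for NODE O.) [folklore] -/
theorem runChain190AtOwnNumbersAt_mono {σ σ' : (F : T4Family) → Node00.Stage13HParams F 2 → ℝ} (hle : ∀ F θ, σ F θ ≤ σ' F θ) (h : RunChain190AtOwnNumbersAt σ) :
    RunChain190AtOwnNumbersAt σ' := fun F θ hP hU hθ hB hwin =>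
  (h F θ hP hU hθ hB hwin).mono (hle F θ)

/-- **★ WHAT 2ᴼᴰ COSTS BEYOND N17 — (AF-0r) FOR `bOwn` PLUS A FLOOR ON THE LIMIT**: if at every tuple carrying the prefix the record's own numbers converge GEOMETRICALLY to some `b_∞`
(`|bOwn F θ k − b_∞| ≤ C ρ^k`, `0 ≤ ρ < 1`, `0 ≤ C` — the conclusion SHAPE of N17 at the Stage-13 record for exactly this object, `…N17AtRecord13Sep.content_of_N17_datumOfRecord₁₃Sep`, under
`Beta0LimitExists` at coherent admissible base histories) AND `σ F θ ≤ b_∞`, then 2ᴼᴰ holds at floor `σ` (`Beta.Drift.drift_of_geometric` BY NAME: slope `b_∞`, constant `C∕(1−ρ)`).  So, given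
N17 at the record, 2ᴼᴰ at `σ := sOwn` is ONE REAL INEQUALITY PER TUPLE, `θ.cβ · stepBal 2 F.L ≤ b_∞(F, θ)` — the asymptotic-freedom VALUE (up to inequality) of the record's own
limiting one-loop number: the identification content (β-cell ∕ def-T ∕ (P6)), relocated from v6's anchor seam into 2ᴼᴰ.  CONDITIONAL bookkeeping; neither hypothesis is proved anywhere
here. [cite: Balaban1987RG1, (1.3) p.260, (2.12)–(2.14) p.268; Balaban1988RG2Cluster, Lemma 3 (2.38) p.20] -/
theorem ownNumbersDriftAt_of_geometricLimit (σ : (F : T4Family) → Node00.Stage13HParams F 2 → ℝ)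
    (h : ∀ (F : T4Family) (θ : Node00.Stage13HParams F 2) (hP : θ.Provisos₁₃SepCoPH F 2), (θ.ZhUnity F 2 ∧ θ.SlotsNondegenerate₁₃ F 2) → θ.Admissible F 2 →
      B16.EndStatementBPrinted (Node00.datumOfRecord₁₃SepCoPH F 2 θ hP).C → Window13 F θ hP →
      ∃ binf C ρ : ℝ, 0 ≤ ρ ∧ ρ < 1 ∧ 0 ≤ C ∧ (∀ k, |bOwn F θ k - binf| ≤ C * ρ ^ k) ∧ σ F θ ≤ binf) :
    OwnNumbersDriftAt σ := fun F θ hP hU hθ hB hwin => by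
  obtain ⟨binf, C, ρ, hρ0, hρ1, hC, hrate, hfloor⟩ := h F θ hP hU hθ hB hwin
  exact ⟨binf, C / (1 - ρ), hfloor, drift_of_geometric hρ0 hρ1 hC hrate⟩

/-! ### §3b The DRIFT-KEYED seam (row-D4 owner an4's reading of (q-K2-3), bus l.29930 (B)): 2ᴼᴰ⁺ carries only the drift AND ITS SIGN, 1ᴼᴿ⁺ states NODE O's cap
against WHATEVER positive slope the own numbers drift with — no `stepBal`, no numeral, print's order of quantifiers («one-loop slope first, thresholds after», [I] Thm 3 p. 264) -/

/-- **TEXT 2ᴼᴰ⁺ (drift-keyed): «THE RECORD's OWN ONE-LOOP NUMBERS DRIFT WITH SOME POSITIVE SLOPE»** — `prefix → ∃ s A, 0 < s ∧ OneLoopDrift s A (bOwn F θ)` (row (D1) + the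
asymptotic-freedom SIGN at NODE O's own numbers; β-cell ∕ CAP-row content, κ-free, `stepBal`-free).  HYPOTHESIS SHAPE ∕ obligation text, never a fact.  (an4's (B), verbatim up to
the name `bOwn`.) [folklore] -/
def OwnNumbersDriftPos : Prop :=
  ∀ (F : T4Family) (θ : Node00.Stage13HParams F 2) (hP : θ.Provisos₁₃SepCoPH F 2), (θ.ZhUnity F 2 ∧ θ.SlotsNondegenerate₁₃ F 2) → θ.Admissible F 2 →
    B16.EndStatementBPrinted (Node00.datumOfRecord₁₃SepCoPH F 2 θ hP).C → Window13 F θ hP →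
    ∃ s A : ℝ, 0 < s ∧ OneLoopDrift s A (bOwn F θ)

/-- **TEXT 1ᴼᴿ⁺ (drift-keyed): «GIVEN ANY POSITIVE DRIFT OF ITS OWN NUMBERS, THE RECORD CARRIES THE RUN-WISE (190)-CHAIN RELATIVE TO THEM WITH CAP BELOW THAT SLOPE»** —
`prefix → ∀ s A, 0 < s → OneLoopDrift s A (bOwn F θ) → RunChain190At F θ hP (bOwn F θ) s` (NODE O's wall WITH print's smallness `ε₁·K_rem,L ≤ s` inside the NODE-O text, chosen after
the slope — DECISION-204 placement; the drift slope being unique when it exists, `Gaps.D1Residue.oneLoopDrift_slope_unique`, the `∀ s` ranges over at most one value per tuple).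
HYPOTHESIS SHAPE ∕ obligation text, never a fact; size XL (NODE O; [I] Thm 2 p. 259 unproved in print; instance 0∕1).  (an4's (B), verbatim up to the names.) [folklore] -/
def RunChain190AtOwnDriftSlope : Prop :=
  ∀ (F : T4Family) (θ : Node00.Stage13HParams F 2) (hP : θ.Provisos₁₃SepCoPH F 2), (θ.ZhUnity F 2 ∧ θ.SlotsNondegenerate₁₃ F 2) → θ.Admissible F 2 →
    B16.EndStatementBPrinted (Node00.datumOfRecord₁₃SepCoPH F 2 θ hP).C → Window13 F θ hP →
    ∀ s A : ℝ, 0 < s → OneLoopDrift s A (bOwn F θ) → RunChain190At F θ hP (bOwn F θ) s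

/-- **★★ THE DRIFT-KEYED PAIR ⟹ THE CRUX DECL BY NAME**: `OwnNumbersDriftPos → RunChain190AtOwnDriftSlope → EndpointGivenBR13SepCoPH` (one `obtain`, then p606097's END via
`endpointExistence_of_runChain190At_drift`).  A registered v7 `{stub_ownDriftPos13 : OwnNumbersDriftPos, stub_runChainOwnSlope13 : RunChain190AtOwnDriftSlope}` closes sorry-free by
`EndpointGivenBR13SepCoPH_of_ownNumbersDriftKeyed stub_ownDriftPos13 stub_runChainOwnSlope13`.  CONDITIONAL on the two displayed texts; K2⁷ NOT closed; nothing of Bałaban asserted.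
[cite: Balaban1987RG1, Thm 2 p.259 (first sentence), Thm 3 p.264, (2.12)–(2.14) p.268 and (5.10) p.293; Balaban1988RG2Cluster, Lemma 3 (2.38) p.20] -/
theorem EndpointGivenBR13SepCoPH_of_ownNumbersDriftKeyed (h₁ : OwnNumbersDriftPos) (h₂ : RunChain190AtOwnDriftSlope) :
    Summit.QuantumFields.YangMills.Theses.BalabanUVNodes.EndpointGivenBR13SepCoPH := by
  intro F θ hP hU hθ hB hwin
  obtain ⟨s, A, hs, hd⟩ := h₁ F θ hP hU hθ hB hwin
  exact endpointExistence_of_runChain190At_drift F θ hP (h₂ F θ hP hU hθ hB hwin s A hs hd) hd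

/-- The drift-keyed pair ⟹ p606097's one text VERBATIM, too (witness `b := bOwn F θ` and the drift's own slope). [folklore] -/
theorem ownDriftRunChain190K_of_ownNumbersDriftKeyed (h₁ : OwnNumbersDriftPos) (h₂ : RunChain190AtOwnDriftSlope) :
    ∀ (F : T4Family) (θ : Node00.Stage13HParams F 2) (hP : θ.Provisos₁₃SepCoPH F 2),
      (θ.ZhUnity F 2 ∧ θ.SlotsNondegenerate₁₃ F 2) → θ.Admissible F 2 →
      B16.EndStatementBPrinted (Node00.datumOfRecord₁₃SepCoPH F 2 θ hP).C →
      (∃ γ₁ : ℝ, 0 < γ₁ ∧ ∀ γ : ℝ, 0 < γ → γ ≤ γ₁ →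
        ∃ P : B12.RunParams, 1 ≤ P.K ∧ ((Node00.datumOfRecord₁₃SepCoPH F 2 θ hP).C P).flow.InInterval γ P.K) →
      ∃ (b : ℕ → ℝ) (s A : ℝ) (M : ℕ) (_ : NeZero M) (μ ν : Fin 4) (c : B13.Consts) (ℓ α₂ : ℝ) (q : Consts190) (γ₀ : ℝ),
        (∀ (n : ℕ) (gs : ℕ → ℝ), RGEqH n (Node00.datumOfRecord₁₃SepCoPH F 2 θ hP).βfun gs → Step.InInterval γ₀ n gs → ∀ k, k ≤ n →
          ∃ a : LDom 4 → Pt 4 → ℝ, (Node00.datumOfRecord₁₃SepCoPH F 2 θ hP).βfun k (prefixOf gs k) - b k =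
            B12Beta.secondMoment (fun _ _ => limKernel a) μ ν ∧ Nonempty (PolLeavesTFac190H 4 M a c ℓ α₂ q)) ∧
        CondsL 4 c ℓ ∧ c.R22gen ℓ ∧ q.Valid c.δ₀ ∧ SignsL c α₂ q.B₃ ∧ 0 < γ₀ ∧
        c.ε₁ * remCoeffL 4 M c α₂ q.B₃ ≤ s ∧ OneLoopDrift s A b ∧
        SurvCont (Node00.datumOfRecord₁₃SepCoPH F 2 θ hP).βfun γ₀ := by
  intro F θ hP hU hθ hB hwin
  obtain ⟨s, A, hs, hd⟩ := h₁ F θ hP hU hθ hB hwin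
  obtain ⟨M, iM, μ, ν, c, ℓ, α₂, q, γ₀, hrun, hC, h22, hq, hsg, hγ₀, hcap, hcont⟩ := h₂ F θ hP hU hθ hB hwin s A hs hd
  exact ⟨bOwn F θ, s, A, M, iM, μ, ν, c, ℓ, α₂, q, γ₀, hrun, hC, h22, hq, hsg, hγ₀, hcap, hd, hcont⟩

/-- FLOOR ⟹ SIGN: a drift at a floor `σ` that is positive at admissible tuples (e.g. `σ := sOwn`, `sOwn_pos`) gives the drift-keyed 2ᴼᴰ⁺. [folklore] -/
theorem ownNumbersDriftPos_of_driftAt {σ : (F : T4Family) → Node00.Stage13HParams F 2 → ℝ}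
    (hσ : ∀ (F : T4Family) (θ : Node00.Stage13HParams F 2), θ.Admissible F 2 → 0 < σ F θ) (h : OwnNumbersDriftAt σ) : OwnNumbersDriftPos :=
  fun F θ hP hU hθ hB hwin => by
    obtain ⟨s, A, hle, hd⟩ := h F θ hP hU hθ hB hwin
    exact ⟨s, A, (hσ F θ hθ).trans_le hle, hd⟩

/-- … in particular `OwnNumbersDrift → OwnNumbersDriftPos` (the slope letter of record is positive at admissible tuples). [folklore] -/
theorem ownNumbersDriftPos_of_ownNumbersDrift (h : OwnNumbersDrift) : OwnNumbersDriftPos :=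
  ownNumbersDriftPos_of_driftAt (σ := sOwn) (fun F θ hθ => sOwn_pos F θ hθ) h

/-- SLOPE-KEYED NODE O TEXT + EXACT DRIFT AT A POSITIVE `σ` ⟹ THE CAP-KEYED TEXT AT `σ`: if NODE O serves every positive drift slope (1ᴼᴿ⁺) and the own numbers drift with slope exactly
`σ F θ > 0`, then 1ᴼᴿ holds at cap `σ` (how the two keyings meet). [folklore] -/
theorem runChain190AtOwnNumbersAt_of_driftSlope {σ : (F : T4Family) → Node00.Stage13HParams F 2 → ℝ} (h : RunChain190AtOwnDriftSlope)
    (hσ : ∀ (F : T4Family) (θ : Node00.Stage13HParams F 2), θ.Admissible F 2 → 0 < σ F θ)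
    (hd : ∀ (F : T4Family) (θ : Node00.Stage13HParams F 2) (hP : θ.Provisos₁₃SepCoPH F 2), (θ.ZhUnity F 2 ∧ θ.SlotsNondegenerate₁₃ F 2) → θ.Admissible F 2 →
      B16.EndStatementBPrinted (Node00.datumOfRecord₁₃SepCoPH F 2 θ hP).C → Window13 F θ hP → ∃ A : ℝ, OneLoopDrift (σ F θ) A (bOwn F θ)) :
    RunChain190AtOwnNumbersAt σ := fun F θ hP hU hθ hB hwin => by
  obtain ⟨A, hA⟩ := hd F θ hP hU hθ hB hwin
  exact h F θ hP hU hθ hB hwin (σ F θ) A (hσ F θ hθ) hA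

end Beta3

end Summit.QuantumFields.YangMills.Theorems.BalabanUVNodesK2OwnNumbersDefs

end
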